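import Literature.Topology.FourManifolds.LadderSlideField
import HarnessLib

/-!
# The slide field of the ladder body is symmetric under `y ↦ -y`; the flow on the lower tubes

Topic `Literature/Topology/FourManifolds`; brick E3e of the constructive road (P1′) to
`Literature.Topology.FourManifolds.Trisection.isConnectedSum_of_reducing_separating`
(`ReducibleTrisectionSplitting.lean`, § Status), a complement to `LadderSlideField.lean`:
the slide field `V` of a pair of bridges is equivariant under the reflection
`(x, y, z, w) ↦ (x, -y, z, w)` exchanging the two tubes (`slideField_reflY`), hence so is any
of its flows (`flow_reflY`, uniqueness of integral curves), and on the inner **lower** tube the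
flow is the explicit slide `slideD t = refl ∘ slideU t ∘ refl` (`flow_eq_slideD`).
Everything is **proved**; no named fact is introduced.

## References
* J. M. Lee, *Introduction to Smooth Manifolds*, 2nd ed. (2012), Thm. 9.12. [LeeSmoothManifolds2013]
-/

noncomputable section

open scoped Topology ContDiff Manifold
open Set Filter Real

namespace Literature.Topology.FourManifolds

/-- Local notation: `𝔼 n` is the model Euclidean space `EuclideanSpace ℝ (Fin n)`. -/
local notation "𝔼 " n:arg => EuclideanSpace ℝ (Fin n)

open Metric

namespace Ladder.Params

variable {k : ℕ} (P : Params k)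

/-! ### §1 The slide field is equivariant under `y ↦ -y` -/

omit P in
/-- `etaSum` is even. [folklore] -/
theorem etaSum_neg (y : ℝ) : etaSum (-y) = etaSum y := by
  unfold etaSum
  rw [show (-y - 1) ^ 2 = (y + 1) ^ 2 by ring, show (-y + 1) ^ 2 = (y - 1) ^ 2 by ring, add_comm]

omit P in
/-- `ω` is invariant under the reflection. [folklore] -/
theorem omega_reflY (p : 𝔼 4) : omega k (reflY p) = omega k p := by
  have hn : ∀ q : 𝔼 4, ‖q‖ ^ 2 = q 0 ^ 2 + q 1 ^ 2 + q 2 ^ 2 + q 3 ^ 2 := fun q => by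
    rw [EuclideanSpace.norm_sq_eq, Fin.sum_univ_four]
    simp [Real.norm_eq_abs, sq_abs]
  unfold omega
  rw [hn, hn p]
  simp [reflY]

/-- **Equivariance**: `V (refl p) = refl (V p)`. [folklore] -/
theorem slideField_reflY (i : ℕ) (p : 𝔼 4) : P.slideField i (reflY p) = reflY (P.slideField i p) := by
  have e1 : (-p 1 - 1) ^ 2 = (p 1 + 1) ^ 2 := by ring
  have e2 : (-p 1 + 1) ^ 2 = (p 1 - 1) ^ 2 := by ring
  unfold slideField
  simp only [reflY_apply_zero, reflY_apply_one, reflY_apply_two, reflY_apply_three, omega_reflY, etaSum_neg, e1, e2]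
  conv_rhs => unfold reflY
  simp only [pt4_apply_zero, pt4_apply_one, pt4_apply_two, pt4_apply_three]
  congr 1; ring

omit P in
/-- The reflection of a differentiable curve. [folklore] -/
theorem hasDerivAt_reflY_comp {γ : ℝ → 𝔼 4} {v : 𝔼 4} {t : ℝ} (h : HasDerivAt γ v t) :
    HasDerivAt (fun s => reflY (γ s)) (reflY v) t := by
  have hc : ∀ j : Fin 4, HasDerivAt (fun s => γ s j) (v j) t := fun j =>
    (hasFDerivAt_apply j (γ t)).comp_hasDerivAt t h |>.congr_deriv (by simp)
  unfold reflY
  exact hasDerivAt_pt4 (hc 0) (hc 1).neg (hc 2) (hc 3)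

/-- **A flow of the slide field commutes with the reflection**: `θ (t, refl p) = refl (θ (t, p))`
(both sides are integral curves of the Lipschitz field `V` through `refl p`).
[cite: LeeSmoothManifolds2013, Thm. 9.12] -/
theorem flow_reflY {i : ℕ} (hi : i < k) {θ : ℝ × 𝔼 4 → 𝔼 4} (h0 : ∀ x, θ (0, x) = x)
    (hint : ∀ x t, HasDerivAt (fun t => θ (t, x)) (P.slideField i (θ (t, x))) t) (t : ℝ) (p : 𝔼 4) :
    θ (t, reflY p) = reflY (θ (t, p)) := by
  obtain ⟨C, hC⟩ := (P.contDiff_slideField hi).lipschitzWith_of_hasCompactSupport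
    (P.hasCompactSupport_slideField i) (by simp)
  have key := ODE_solution_unique_univ (v := fun _ => P.slideField i) (s := fun _ => univ) (K := C)
    (f := fun s => θ (s, reflY p)) (g := fun s => reflY (θ (s, p))) (t₀ := 0)
    (fun _ => hC.lipschitzOnWith) (fun s => ⟨hint _ s, mem_univ _⟩)
    (fun s => ⟨?_, mem_univ _⟩) (by simp only [h0])
  · exact congrFun key t
  · have := hasDerivAt_reflY_comp (hint p s)
    rw [← P.slideField_reflY] at this
    exact this

/-! ### §2 The explicit slide along the lower bridge -/

/-- **The slide along the lower bridge**: the conjugate of `slideU` by the reflection. [folklore] -/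
def slideD (t : ℝ) (p : 𝔼 4) : 𝔼 4 := reflY (P.slideU t (reflY p))

omit P in
/-- The reflection is an involution. [folklore] -/
@[simp] theorem reflY_reflY (p : 𝔼 4) : reflY (reflY p) = p := by
  ext j; fin_cases j <;> simp [reflY]

/-- **A flow of the slide field is the explicit slide on the inner lower tube.**
[cite: LeeSmoothManifolds2013, Thm. 9.12] -/
theorem flow_eq_slideD {i : ℕ} (hi : i < k) {θ : ℝ × 𝔼 4 → 𝔼 4} (h0 : ∀ x, θ (0, x) = x)
    (hint : ∀ x t, HasDerivAt (fun t => θ (t, x)) (P.slideField i (θ (t, x))) t)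
    {p : 𝔼 4} (hG : P.bodyG p ≤ P.level) (hy : p 1 ≤ 0) (hx : |p 0 - slabCtr i| < 3 / 8)
    {t : ℝ} (ht : |p 0 + t - slabCtr i| < 3 / 8) : θ (t, p) = P.slideD t p := by
  have h := P.flow_reflY hi h0 hint t (reflY p)
  rw [reflY_reflY] at h
  rw [h, slideD, P.flow_eq_slideU hi h0 hint (p := reflY p) (by rwa [P.bodyG_reflY])
    (by simp; linarith) (by simpa using hx) (by simpa using ht)]

end Ladder.Params

end Literature.Topology.FourManifolds
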